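/-
Copyright (c) 2026 the pub-hodgecm-mathlib formalisation cell (harness21).  Prover seat hodgecm-mathlib-F0P2-p02 (g9), ROAD W brick (W5), 2026-09-01.
-/
import Literature.Combinatorics.SimpleGraph.TreeRetractionOntoSubtree   -- ★ p843004: `TreeRetraction.exists_retraction` (height ∕ parent toward a subtree, equivariance)
import Literature.Combinatorics.SimpleGraph.TreeActionAxis               -- part 1 (F0P2-p02 g9): `adj_zpow_smul_iff`, `connected_induce_axis`, `smul_mem_axis_iff`
import Literature.GroupTheory.OrbitQuotientTubeCount                    -- ★ p843003 §1: `natCard_quotient_orbitRel_comap_eq_of_bijective`, `…_union`, `finite_…_of_subset`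
import Mathlib.Algebra.Group.Action.Pointwise.Set.Basic
import HarnessLib

/-!
# Per period of a translation, «fixed vertices + set-wise fixed edges = fixed darts» on a tree: the combinatorial heart of Kottwitz's NON-ELLIPTIC
# Euler–Poincaré relation for a group acting on a tree WITH inversions (Kottwitz 1988 §2 Thm. 2; Serre, *Trees* I.6.4, II.1.1–1.3)

Topic `Combinatorics/SimpleGraph`; namespace `Literature.Combinatorics.SimpleGraph.TreeAction`.  THEOREMS ONLY (no definition, no instance, no notation, no named fact,
no `sorry`); Mathlib + two ★ orbit-counting ∕ retraction files.  Cell `pub/hodgecm-mathlib`, F0∕P3a, crux H413 = stmt-HodgeConjecture-24833, line «N6nsGerm», residue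
`stub_N6nsR2ram : RankOneEulerPoincareNonsplitRamified`, ROAD W («R2EP-wild»: the letter (R2) at a RAMIFIED place through the tree `X` of `SL₂(F_v)`, on which `U(Φ₂)(E_w)`
acts through `PGL₂(F_v)` WITH inversions — MEMO `F0/P3a/F0P3a-p04/g13/MEMO-R2wild.F0P3a-p04g13.md`), brick (W5) «per-period non-elliptic relation», TREE SIDE; seat F0P2-p02 (g9)
(B-p14 (g32) 10:23:49Z hands: (W1c)(W2) B-p08 (g28), (W3)(W4) B-p14, (W5) F0P2-p02; census `F0/P2/p02/g9/CENSUS-W5-NonEllipticPerPeriod.F0P2p02g9.md`).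
HONEST LABEL: HC_CM is proved only modulo the printed citations until rung 0 closes; this file is pure orbit counting on a tree and asserts nothing printed.

THE MATHEMATICS.  A group `Φ` acts on the vertex set `V` of a tree `G` by graph automorphisms and is generated by one element `τ` which moves a vertex `v₀` to a NEIGHBOUR
and acts freely on it (`τ^n v₀ = v₀ ⇒ n = 0`), so that `Y = τ^ℤ v₀` is the AXIS of the translation `τ` (part 1 ★ `TreeActionAxis`); `γ` is an automorphism commuting with `Φ`.
* If `γ v₀ = v₀` (§3), `γ` fixes `Y` pointwise, the nearest-point retraction `(h, p)` onto `Y` (★ `exists_retraction`) is `γ`- and `Φ`-equivariant, «fixed vertex `↦` the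
  edge below it (`{v, p v}` off the axis, `{v, τv}` on it)» is a `Φ`-equivariant BIJECTION onto the set-wise fixed edges (no fixed edge is inverted: `γ` preserves heights),
  and the fixed darts split equivariantly as «down-or-forward» ⊔ «up-or-backward», each half in bijection with the fixed edges; counting `Φ`-orbits («per period»):
  **`#(fixed vertices∕Φ) + #(fixed edges∕Φ) = #(fixed darts∕Φ)`** (both sides `= 2·#(fixed edges∕Φ)`).
* If `γ v₀ = τ^k v₀`, `k ≠ 0` (§4), the iterated-parent projection onto `Y` shows that `γ` fixes NO vertex, NO edge set-wise, NO dart: `0 + 0 = 0`.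
Orbit counts are typed choice-free as `Nat.card (Quotient ((MulAction.orbitRel Φ X).comap (Subtype.val : S → X)))` (the currency of ★ `OrbitQuotientTubeCount`); edges are
two-element SETS of vertices under the pointwise action («set-wise fixed» is `γ '' s = s`), darts are ordered adjacent pairs; only the dart quotient is assumed finite.
The COSET side (`τ^ℤ ≤ Z_Γ(γ)` on `Γ ⧸ K_v`, `Γ ⧸ K_e`, `Γ ⧸ I`, B-p14 (g32)'s (W3)(W4) binders verbatim) is the sequel ★ `TreeActionNonEllipticPerPeriod`.
* §3 **`natCard_quotient_fixed_vertices_add_edges_eq_darts`** (`γ v₀ = v₀`).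
* §4 `forall_ne_of_apply_eq_zpow_smul`, **`natCard_quotient_fixed_vertices_add_edges_eq_darts_of_ne`** (`k ≠ 0`), and both cases: **`…_eq_darts_of_exists`**.

## References
* [Kottwitz1988] R. E. Kottwitz, *Tamagawa numbers*, Ann. of Math. 127 (1988), 629–646, §2 Theorem 2 (non-elliptic case: `O_γ(f_EP) = 0`).
* [Serre1980Trees] J.-P. Serre, *Trees*, Springer (1980): I.2.2 Prop. 8 (unique geodesics), I.6.4 Prop. 24–25 (hyperbolic automorphisms, axis, projection), II.1.1–1.3
  (the tree of `SL₂`; `GL₂` acts through `PGL₂` with inversions).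
* [Laumon1995] G. Laumon, *Cohomology of Drinfeld Modular Varieties* I (1996), Lemma (5.3.2) (orbital integrals as counts of fixed facets modulo the centraliser).
-/

set_option autoImplicit false

open SimpleGraph MulAction
open scoped Pointwise

namespace Literature.Combinatorics.SimpleGraph.TreeAction

open Literature.Combinatorics.SimpleGraph Literature.GroupTheory

variable {V : Type*} {G : SimpleGraph V} {Φ : Type*} [Group Φ] [MulAction Φ V]

/-! ## §3 Per period: fixed vertices + set-wise fixed edges = fixed darts (`γ` fixing the axis) -/

section Fixed

/-- **PER PERIOD OF THE TRANSLATION `τ`, `#(fixed vertices) + #(set-wise fixed edges) = #(fixed darts)`** for an automorphism `γ` of the tree `G` commuting with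
`Φ = τ^ℤ` and fixing `v₀` (hence the whole axis `Y = τ^ℤ v₀`); orbit counts `#(S∕Φ) = Nat.card (Quotient ((orbitRel Φ X).comap Subtype.val))`, edges two-element sets
under the pointwise action, darts ordered adjacent pairs, only the dart quotient assumed finite.  Proof: retraction `(h, p)` onto `Y` (★ `exists_retraction`), the
equivariant bijection «fixed vertex `↦` edge below it», and the splitting of the fixed darts into «down-or-forward» ⊔ «up-or-backward», each half `≃` fixed edges.
[cite: Kottwitz1988, §2 Theorem 2] [cite: Serre1980Trees, I.6.4 Prop. 24–25; II.1.1] [cite: Laumon1995, Lemma (5.3.2)] -/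
theorem natCard_quotient_fixed_vertices_add_edges_eq_darts (hT : G.IsTree)
    (hadj : ∀ (φ : Φ) (a b : V), G.Adj (φ • a) (φ • b) ↔ G.Adj a b) (τ : Φ) (hgen : ∀ φ : Φ, ∃ n : ℤ, τ ^ n = φ) (v₀ : V)
    (hstep : G.Adj v₀ (τ • v₀)) (hfree : ∀ n : ℤ, τ ^ n • v₀ = v₀ → n = 0)
    (γ : V ≃ V) (hγadj : ∀ a b : V, G.Adj (γ a) (γ b) ↔ G.Adj a b) (hcomm : ∀ (φ : Φ) (v : V), φ • γ v = γ (φ • v)) (hγ₀ : γ v₀ = v₀)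
    (hfinD : Finite (Quotient ((MulAction.orbitRel Φ (V × V)).comap
      (Subtype.val : {d : V × V | G.Adj d.1 d.2 ∧ γ d.1 = d.1 ∧ γ d.2 = d.2} → V × V)))) :
    Nat.card (Quotient ((MulAction.orbitRel Φ V).comap (Subtype.val : {v : V | γ v = v} → V))) +
        Nat.card (Quotient ((MulAction.orbitRel Φ (Set V)).comap
          (Subtype.val : {s : Set V | (∃ a b : V, G.Adj a b ∧ s = {a, b}) ∧ γ '' s = s} → Set V))) =
      Nat.card (Quotient ((MulAction.orbitRel Φ (V × V)).comap
        (Subtype.val : {d : V × V | G.Adj d.1 d.2 ∧ γ d.1 = d.1 ∧ γ d.2 = d.2} → V × V))) := by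
  classical
  set Y : Set V := {v : V | ∃ n : ℤ, τ ^ n • v₀ = v} with hY
  set FV : Set V := {v : V | γ v = v} with hFV
  set FE : Set (Set V) := {s : Set V | (∃ a b : V, G.Adj a b ∧ s = {a, b}) ∧ γ '' s = s} with hFE
  set FD : Set (V × V) := {d : V × V | G.Adj d.1 d.2 ∧ γ d.1 = d.1 ∧ γ d.2 = d.2} with hFD
  /- (0) the axis -/
  have h0Y : v₀ ∈ Y := ⟨0, by rw [zpow_zero, one_smul]⟩
  have hYΦ : ∀ (φ : Φ) (v : V), φ • v ∈ Y ↔ v ∈ Y := smul_mem_axis_iff τ hgen v₀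
  have hYγ : ∀ y ∈ Y, γ y = y := by
    rintro _ ⟨n, rfl⟩
    rw [← hcomm, hγ₀]
  have hline := adj_zpow_smul_iff hT.isAcyclic hadj τ v₀ hstep hfree
  have hτcomm : ∀ (φ : Φ) (v : V), φ • τ • v = τ • φ • v := fun φ v => by
    simpa only [zpow_one] using smul_comm_of_generator τ hgen φ 1 v
  have hcancel : ∀ a b : ℤ, τ ^ a • v₀ = τ ^ b • v₀ → a = b := fun a b hab => by
    have h' := congrArg (fun x => τ ^ (-b) • x) hab
    simp only [smul_smul, ← zpow_add, neg_add_cancel, zpow_zero, one_smul] at h'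
    have := hfree _ h'
    omega
  have hτY : ∀ y ∈ Y, τ • y ∈ Y := fun y hy => (hYΦ τ y).2 hy
  have hτ2 : ∀ y ∈ Y, τ • τ • y ≠ y := by
    rintro _ ⟨n, rfl⟩ h2
    have h3 : τ ^ (1 + (1 + n)) • v₀ = τ ^ n • v₀ := by
      rw [zpow_add, mul_smul, zpow_add, mul_smul, zpow_one]; exact h2
    have := hcancel _ _ h3
    omega
  have hτsucc : ∀ m : ℤ, τ • τ ^ m • v₀ = τ ^ (m + 1) • v₀ := fun m => by
    rw [zpow_add_one, mul_smul, hτcomm]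
  /- (1) the retraction onto the axis and its equivariance -/
  obtain ⟨h, p, -, hzero, hpar, hedge, -, hequi⟩ :=
    TreeRetraction.exists_retraction hT ⟨v₀, h0Y⟩ (connected_induce_axis hadj τ v₀ hstep)
  have hequiΦ : ∀ (φ : Φ) (v : V), h (φ • v) = h v ∧ (v ∉ Y → p (φ • v) = φ • p v) := fun φ v =>
    hequi ({ toEquiv := MulAction.toPerm φ, map_rel_iff' := fun {a b} => hadj φ a b } : G ≃g G) (fun v => hYΦ φ v) v
  have hYγiff : ∀ v : V, γ v ∈ Y ↔ v ∈ Y := fun v =>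
    ⟨fun hv => by rwa [← γ.injective (hYγ _ hv)], fun hv => by rwa [hYγ v hv]⟩
  have hequiγ : ∀ v : V, h (γ v) = h v ∧ (v ∉ Y → p (γ v) = γ (p v)) := fun v =>
    hequi ({ toEquiv := γ, map_rel_iff' := fun {a b} => hγadj a b } : G ≃g G) hYγiff v
  -- no fixed edge is inverted by `γ`
  have hnoinv : ∀ a b : V, G.Adj a b → γ a = b → γ b = a → False := fun a b hab hγa hγb => by
    by_cases hab' : a ∈ Y ∧ b ∈ Y
    · exact hab.ne ((hYγ a hab'.1).symm.trans hγa)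
    · rcases hedge a b hab hab' with ⟨haY, hpa⟩ | ⟨hbY, hpb⟩
      · have h1 := (hpar a haY).2
        rw [hpa, ← hγa, (hequiγ a).1] at h1
        omega
      · have h1 := (hpar b hbY).2
        rw [hpb, ← hγb, (hequiγ b).1] at h1
        omega
  -- hence a set-wise fixed edge is fixed pointwise
  have hFE_fix : ∀ a b : V, G.Adj a b → γ '' {a, b} = {a, b} → γ a = a ∧ γ b = b := fun a b hab hfix => by
    rw [Set.image_pair, Set.pair_eq_pair_iff] at hfix
    rcases hfix with hfix | ⟨hγa, hγb⟩
    · exact hfix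
    · exact (hnoinv a b hab hγa hγb).elim
  /- (2) the bijection «fixed vertex ↦ the edge below it» -/
  let fval : V → Set V := fun v => if v ∈ Y then {v, τ • v} else {v, p v}
  have hfval_Y : ∀ v ∈ Y, fval v = {v, τ • v} := fun v hv => if_pos hv
  have hfval_off : ∀ v ∉ Y, fval v = {v, p v} := fun v hv => if_neg hv
  have hfval_mem : ∀ v ∈ FV, fval v ∈ FE := fun v hv => by
    by_cases hvY : v ∈ Y
    · rw [hfval_Y v hvY]
      obtain ⟨n, rfl⟩ := id hvY
      refine ⟨⟨_, _, ?_, rfl⟩, ?_⟩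
      · rw [← hτcomm]; exact (hadj _ _ _).2 hstep
      · rw [Set.image_pair, hYγ _ hvY, hYγ _ (hτY _ hvY)]
    · rw [hfval_off v hvY]
      refine ⟨⟨_, _, (hpar v hvY).1, rfl⟩, ?_⟩
      rw [Set.image_pair, ← (hequiγ v).2 hvY, show γ v = v from hv]
  have hfval_smul : ∀ (φ : Φ) (v : V), fval (φ • v) = φ • fval v := fun φ v => by
    by_cases hvY : v ∈ Y
    · rw [hfval_Y v hvY, hfval_Y _ ((hYΦ φ v).2 hvY), Set.smul_set_insert, Set.smul_set_singleton, hτcomm]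
    · rw [hfval_off v hvY, hfval_off _ (fun h' => hvY ((hYΦ φ v).1 h')), Set.smul_set_insert, Set.smul_set_singleton, (hequiΦ φ v).2 hvY]
  have hfval_inj : ∀ v w : V, fval v = fval w → v = w := fun v w hvw => by
    by_cases hvY : v ∈ Y <;> by_cases hwY : w ∈ Y
    · rw [hfval_Y v hvY, hfval_Y w hwY, Set.pair_eq_pair_iff] at hvw
      rcases hvw with ⟨hvw, -⟩ | ⟨h1, h2⟩
      · exact hvw
      · exact (hτ2 w hwY (by rw [← h1, h2])).elim
    · rw [hfval_Y v hvY, hfval_off w hwY, Set.pair_eq_pair_iff] at hvw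
      rcases hvw with ⟨h1, -⟩ | ⟨-, h2⟩
      · exact (hwY (h1 ▸ hvY)).elim
      · exact (hwY (h2 ▸ hτY v hvY)).elim
    · rw [hfval_off v hvY, hfval_Y w hwY, Set.pair_eq_pair_iff] at hvw
      rcases hvw with ⟨h1, -⟩ | ⟨h1, -⟩
      · exact (hvY (h1 ▸ hwY)).elim
      · exact (hvY (h1 ▸ hτY w hwY)).elim
    · rw [hfval_off v hvY, hfval_off w hwY, Set.pair_eq_pair_iff] at hvw
      rcases hvw with ⟨hvw, -⟩ | ⟨h1, h2⟩
      · exact hvw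
      · have h3 := (hpar v hvY).2
        have h4 := (hpar w hwY).2
        rw [h2] at h3
        rw [← h1] at h4
        omega
  have hfval_surj : ∀ s ∈ FE, ∃ v ∈ FV, fval v = s := by
    rintro _ ⟨⟨a, b, hab, rfl⟩, hfix⟩
    obtain ⟨hγa, hγb⟩ := hFE_fix a b hab hfix
    by_cases hab' : a ∈ Y ∧ b ∈ Y
    · obtain ⟨⟨m, rfl⟩, ⟨n, rfl⟩⟩ := hab'
      rcases (hline m n).1 hab with rfl | rfl
      · exact ⟨_, hγa, by rw [hfval_Y _ ⟨m, rfl⟩, hτsucc]⟩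
      · exact ⟨_, hγb, by rw [hfval_Y _ ⟨n, rfl⟩, hτsucc, Set.pair_comm]⟩
    · rcases hedge a b hab hab' with ⟨haY, hpa⟩ | ⟨hbY, hpb⟩
      · exact ⟨a, hγa, by rw [hfval_off a haY, hpa]⟩
      · exact ⟨b, hγb, by rw [hfval_off b hbY, hpb, Set.pair_comm]⟩
  let f : FV → FE := fun v => ⟨fval v, hfval_mem v v.2⟩
  have hf : Function.Bijective f := by
    refine ⟨fun v w hvw => Subtype.ext (hfval_inj _ _ (congrArg Subtype.val hvw)), fun s => ?_⟩
    obtain ⟨v, hv, hvs⟩ := hfval_surj s.1 s.2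
    exact ⟨⟨v, hv⟩, Subtype.ext hvs⟩
  have hVE := (natCard_quotient_orbitRel_comap_eq_of_bijective (Φ := Φ) FV FE f hf fun s t => by
    constructor
    · rintro ⟨φ, hφ⟩
      exact ⟨φ, by rw [show ((f t : FE) : Set V) = fval t from rfl, show ((f s : FE) : Set V) = fval s from rfl, ← hfval_smul, hφ]⟩
    · rintro ⟨φ, hφ⟩
      rw [show ((f t : FE) : Set V) = fval t from rfl, show ((f s : FE) : Set V) = fval s from rfl, ← hfval_smul] at hφ
      exact ⟨φ, hfval_inj _ _ hφ⟩).1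
  /- (3) the fixed darts: «down-or-forward» ⊔ «up-or-backward» -/
  set D1 : Set (V × V) := {d : V × V | d ∈ FD ∧ ((d.1 ∉ Y ∧ p d.1 = d.2) ∨ (d.1 ∈ Y ∧ d.2 = τ • d.1))} with hD1
  set D2 : Set (V × V) := {d : V × V | d ∈ FD ∧ ((d.2 ∉ Y ∧ p d.2 = d.1) ∨ (d.2 ∈ Y ∧ d.1 = τ • d.2))} with hD2
  have hexcl : ∀ a b : V, ((a ∉ Y ∧ p a = b) ∨ (a ∈ Y ∧ b = τ • a)) → ((b ∉ Y ∧ p b = a) ∨ (b ∈ Y ∧ a = τ • b)) → False := by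
    rintro a b (⟨haY, hpa⟩ | ⟨haY, hba⟩) (⟨hbY, hpb⟩ | ⟨hbY, hab⟩)
    · have h1 := (hpar a haY).2
      have h2 := (hpar b hbY).2
      rw [hpa] at h1
      rw [hpb] at h2
      omega
    · exact haY (hab ▸ hτY b hbY)
    · exact hbY (hba ▸ hτY a haY)
    · exact hτ2 a haY (by rw [← hba, ← hab])
  have hFDinv : ∀ (φ : Φ) (d : V × V), d ∈ FD → φ • d ∈ FD := fun φ d hd => by
    refine ⟨(hadj φ _ _).2 hd.1, ?_, ?_⟩
    · show γ (φ • d.1) = φ • d.1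
      rw [← hcomm, hd.2.1]
    · show γ (φ • d.2) = φ • d.2
      rw [← hcomm, hd.2.2]
  have hcond_inv : ∀ (φ : Φ) (a b : V), ((a ∉ Y ∧ p a = b) ∨ (a ∈ Y ∧ b = τ • a)) →
      ((φ • a ∉ Y ∧ p (φ • a) = φ • b) ∨ (φ • a ∈ Y ∧ φ • b = τ • φ • a)) := by
    rintro φ a b (⟨haY, hpa⟩ | ⟨haY, hba⟩)
    · exact Or.inl ⟨fun h' => haY ((hYΦ φ a).1 h'), by rw [(hequiΦ φ a).2 haY, hpa]⟩
    · exact Or.inr ⟨(hYΦ φ a).2 haY, by rw [hba, hτcomm]⟩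
  have hD1inv : ∀ (φ : Φ) (d : V × V), d ∈ D1 → φ • d ∈ D1 := fun φ d hd =>
    ⟨hFDinv φ d hd.1, hcond_inv φ d.1 d.2 hd.2⟩
  have hswap : ∀ d : V × V, d ∈ D2 ↔ d.swap ∈ D1 := fun d => by
    simp only [hD1, hD2, hFD, Set.mem_setOf_eq, Prod.fst_swap, Prod.snd_swap]
    exact ⟨fun ⟨⟨h1, h2, h3⟩, h4⟩ => ⟨⟨h1.symm, h3, h2⟩, h4⟩, fun ⟨⟨h1, h2, h3⟩, h4⟩ => ⟨⟨h1.symm, h3, h2⟩, h4⟩⟩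
  have hcover : ∀ d ∈ FD, d ∈ D1 ∨ d ∈ D2 := by
    rintro ⟨a, b⟩ hd
    have hab : G.Adj a b := hd.1
    by_cases hab' : a ∈ Y ∧ b ∈ Y
    · obtain ⟨⟨m, hm⟩, ⟨n, hn⟩⟩ := hab'
      have hab2 := hab
      rw [← hm, ← hn] at hab2
      rcases (hline m n).1 hab2 with rfl | rfl
      · exact Or.inl ⟨hd, Or.inr ⟨⟨m, hm⟩, by rw [← hm, ← hn, hτsucc]⟩⟩
      · exact Or.inr ⟨hd, Or.inr ⟨⟨n, hn⟩, by rw [← hm, ← hn, hτsucc]⟩⟩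
    · rcases hedge a b hab hab' with h1 | h1
      · exact Or.inl ⟨hd, Or.inl h1⟩
      · exact Or.inr ⟨hd, Or.inl h1⟩
  have hunion : D1 ∪ D2 = FD := by
    refine Set.ext fun d => ⟨?_, fun hd => hcover d hd⟩
    rintro (hd | hd)
    · exact hd.1
    · exact hd.1
  have hdisj : Disjoint D1 D2 := Set.disjoint_left.2 fun d h1 h2 => hexcl d.1 d.2 h1.2 h2.2
  -- finiteness of the two halves
  have hfin1 : Finite (Quotient ((MulAction.orbitRel Φ (V × V)).comap (Subtype.val : D1 → V × V))) :=
    finite_quotient_orbitRel_comap_of_subset (fun d hd => (hunion ▸ Or.inl hd : d ∈ FD)) hfinD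
  have hfin2 : Finite (Quotient ((MulAction.orbitRel Φ (V × V)).comap (Subtype.val : D2 → V × V))) :=
    finite_quotient_orbitRel_comap_of_subset (fun d hd => (hunion ▸ Or.inr hd : d ∈ FD)) hfinD
  obtain ⟨-, hsum⟩ := natCard_quotient_orbitRel_comap_union (Φ := Φ) D1 D2 hdisj hD1inv hfin1 hfin2
  rw [hunion] at hsum
  -- `D1 ≃ FE` by `(a, b) ↦ {a, b}`
  have hg1_mem : ∀ d ∈ D1, ({d.1, d.2} : Set V) ∈ FE := fun d hd =>
    ⟨⟨_, _, hd.1.1, rfl⟩, by rw [Set.image_pair, hd.1.2.1, hd.1.2.2]⟩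
  let g1 : D1 → FE := fun d => ⟨{d.1.1, d.1.2}, hg1_mem d.1 d.2⟩
  have hg1_inj : ∀ d d' : V × V, d ∈ D1 → d' ∈ D1 → ({d.1, d.2} : Set V) = {d'.1, d'.2} → d = d' := by
    rintro ⟨a, b⟩ ⟨a', b'⟩ hd hd' hdd
    rw [Set.pair_eq_pair_iff] at hdd
    rcases hdd with ⟨rfl, rfl⟩ | ⟨rfl, rfl⟩
    · rfl
    · exact (hexcl _ _ hd.2 hd'.2).elim
  have hg1 : Function.Bijective g1 := by
    refine ⟨fun d d' hdd => Subtype.ext (hg1_inj _ _ d.2 d'.2 (congrArg Subtype.val hdd)), ?_⟩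
    rintro ⟨_, ⟨a, b, hab, rfl⟩, hfix⟩
    obtain ⟨hγa, hγb⟩ := hFE_fix a b hab hfix
    rcases hcover (a, b) ⟨hab, hγa, hγb⟩ with hd | hd
    · exact ⟨⟨(a, b), hd⟩, rfl⟩
    · exact ⟨⟨(b, a), (hswap (a, b)).1 hd⟩, Subtype.ext (Set.pair_comm b a)⟩
  have hD1E := (natCard_quotient_orbitRel_comap_eq_of_bijective (Φ := Φ) D1 FE g1 hg1 fun s t => by
    constructor
    · rintro ⟨φ, hφ⟩
      refine ⟨φ, ?_⟩
      show φ • ({t.1.1, t.1.2} : Set V) = {s.1.1, s.1.2}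
      rw [Set.smul_set_insert, Set.smul_set_singleton, ← hφ]; rfl
    · rintro ⟨φ, hφ⟩
      change φ • ({t.1.1, t.1.2} : Set V) = {s.1.1, s.1.2} at hφ
      rw [Set.smul_set_insert, Set.smul_set_singleton] at hφ
      exact ⟨φ, hg1_inj (φ • t.1) s.1 (hD1inv φ t.1 t.2) s.2 hφ⟩).1
  -- `D2 ≃ D1` by the swap
  let g2 : D2 → D1 := fun d => ⟨d.1.swap, (hswap d.1).1 d.2⟩
  have hg2 : Function.Bijective g2 := by
    refine ⟨fun d d' hdd => Subtype.ext (Prod.swap_injective (congrArg Subtype.val hdd)), fun d => ?_⟩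
    exact ⟨⟨d.1.swap, (hswap d.1.swap).2 (by rw [Prod.swap_swap]; exact d.2)⟩, Subtype.ext (Prod.swap_swap d.1)⟩
  have hD2D1 := (natCard_quotient_orbitRel_comap_eq_of_bijective (Φ := Φ) D2 D1 g2 hg2 fun s t => by
    constructor
    · rintro ⟨φ, hφ⟩
      exact ⟨φ, by rw [show ((g2 t : D1) : V × V) = t.1.swap from rfl, show ((g2 s : D1) : V × V) = s.1.swap from rfl, ← hφ]; rfl⟩
    · rintro ⟨φ, hφ⟩
      rw [show ((g2 t : D1) : V × V) = t.1.swap from rfl, show ((g2 s : D1) : V × V) = s.1.swap from rfl] at hφ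
      exact ⟨φ, Prod.swap_injective (by rw [← hφ]; rfl)⟩).1
  /- (4) count -/
  rw [hVE, hsum, hD2D1, hD1E]

end Fixed

/-! ## §4 The hyperbolic case: an automorphism translating the axis fixes nothing -/

section Hyperbolic

/-- **An automorphism `γ` commuting with `Φ = τ^ℤ` and TRANSLATING the axis (`γ v₀ = τ^k v₀`, `k ≠ 0`) fixes no vertex**: the iterated-parent projection of a
fixed vertex onto the axis `Y = τ^ℤ v₀` would be a fixed vertex of `Y`, on which `γ` is the translation by `k`. [cite: Serre1980Trees, I.6.4 Prop. 25] -/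
theorem forall_ne_of_apply_eq_zpow_smul (hT : G.IsTree)
    (hadj : ∀ (φ : Φ) (a b : V), G.Adj (φ • a) (φ • b) ↔ G.Adj a b) (τ : Φ) (hgen : ∀ φ : Φ, ∃ n : ℤ, τ ^ n = φ) (v₀ : V)
    (hstep : G.Adj v₀ (τ • v₀)) (hfree : ∀ n : ℤ, τ ^ n • v₀ = v₀ → n = 0)
    (γ : V ≃ V) (hγadj : ∀ a b : V, G.Adj (γ a) (γ b) ↔ G.Adj a b) (hcomm : ∀ (φ : Φ) (v : V), φ • γ v = γ (φ • v))
    {k : ℤ} (hγ₀ : γ v₀ = τ ^ k • v₀) (hk : k ≠ 0) (v : V) : γ v ≠ v := by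
  classical
  set Y : Set V := {v : V | ∃ n : ℤ, τ ^ n • v₀ = v} with hY
  have h0Y : v₀ ∈ Y := ⟨0, by rw [zpow_zero, one_smul]⟩
  have hYΦ : ∀ (φ : Φ) (v : V), φ • v ∈ Y ↔ v ∈ Y := smul_mem_axis_iff τ hgen v₀
  have hcancel : ∀ a b : ℤ, τ ^ a • v₀ = τ ^ b • v₀ → a = b := fun a b hab => by
    have h' := congrArg (fun x => τ ^ (-b) • x) hab
    simp only [smul_smul, ← zpow_add, neg_add_cancel, zpow_zero, one_smul] at h'
    have := hfree _ h'
    omega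
  -- `γ` maps the axis onto itself (translating it by `k`)
  have hγY : ∀ v : V, γ v ∈ Y ↔ v ∈ Y := fun v => by
    constructor
    · rintro ⟨n, hn⟩
      have h1 : γ (τ ^ (n - k) • v₀) = γ v := by
        rw [← hcomm, hγ₀, smul_smul, ← zpow_add, sub_add_cancel, hn]
      exact ⟨n - k, γ.injective h1⟩
    · rintro ⟨n, rfl⟩
      exact ⟨n + k, by rw [zpow_add, mul_smul, ← hγ₀, hcomm]⟩
  obtain ⟨h, p, -, hzero, hpar, -, -, hequi⟩ :=
    TreeRetraction.exists_retraction hT ⟨v₀, h0Y⟩ (connected_induce_axis hadj τ v₀ hstep)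
  have hequiγ : ∀ v : V, h (γ v) = h v ∧ (v ∉ Y → p (γ v) = γ (p v)) := fun v =>
    hequi ({ toEquiv := γ, map_rel_iff' := fun {a b} => hγadj a b } : G ≃g G) hγY v
  -- the iterated parent: height bookkeeping and `γ`-equivariance
  have hiter : ∀ (j : ℕ) (v : V), j ≤ h v → h (p^[j] v) + j = h v ∧ γ (p^[j] v) = p^[j] (γ v) := by
    intro j
    induction j with
    | zero => intro v _; exact ⟨by rw [Function.iterate_zero, id, add_zero], by rw [Function.iterate_zero, id, id]⟩
    | succ j ih =>
      intro v hj
      obtain ⟨h1, h2⟩ := ih v (by omega)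
      have hnotY : p^[j] v ∉ Y := fun hjY => by
        have := (hzero _).2 hjY
        omega
      rw [Function.iterate_succ_apply', Function.iterate_succ_apply']
      refine ⟨by have := (hpar _ hnotY).2; omega, ?_⟩
      rw [← (hequiγ _).2 hnotY, h2]
  intro hv
  obtain ⟨hy1, hy2⟩ := hiter (h v) v le_rfl
  obtain ⟨m, hm⟩ : p^[h v] v ∈ Y := (hzero _).1 (by omega)
  rw [hv] at hy2
  -- `γ (τ^m v₀) = τ^(m+k) v₀` but `γ` fixes `p^[h v] v = τ^m v₀`
  have h3 : τ ^ (m + k) • v₀ = τ ^ m • v₀ := by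
    rw [zpow_add, mul_smul, ← hγ₀, hcomm, hm, hy2]
  have := hcancel _ _ h3
  omega

/-- **PER PERIOD, `0 + 0 = 0` IN THE HYPERBOLIC CASE**: if `γ v₀ = τ^k v₀` with `k ≠ 0` then `γ` fixes no vertex, no edge set-wise (an inverted edge would be fixed by
`γ²`, which translates by `2k ≠ 0`) and no dart, so all three per-period counts vanish. [cite: Kottwitz1988, §2 Theorem 2] [cite: Serre1980Trees, I.6.4 Prop. 25] -/
theorem natCard_quotient_fixed_vertices_add_edges_eq_darts_of_ne (hT : G.IsTree)
    (hadj : ∀ (φ : Φ) (a b : V), G.Adj (φ • a) (φ • b) ↔ G.Adj a b) (τ : Φ) (hgen : ∀ φ : Φ, ∃ n : ℤ, τ ^ n = φ) (v₀ : V)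
    (hstep : G.Adj v₀ (τ • v₀)) (hfree : ∀ n : ℤ, τ ^ n • v₀ = v₀ → n = 0)
    (γ : V ≃ V) (hγadj : ∀ a b : V, G.Adj (γ a) (γ b) ↔ G.Adj a b) (hcomm : ∀ (φ : Φ) (v : V), φ • γ v = γ (φ • v))
    {k : ℤ} (hγ₀ : γ v₀ = τ ^ k • v₀) (hk : k ≠ 0) :
    Nat.card (Quotient ((MulAction.orbitRel Φ V).comap (Subtype.val : {v : V | γ v = v} → V))) +
        Nat.card (Quotient ((MulAction.orbitRel Φ (Set V)).comap
          (Subtype.val : {s : Set V | (∃ a b : V, G.Adj a b ∧ s = {a, b}) ∧ γ '' s = s} → Set V))) =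
      Nat.card (Quotient ((MulAction.orbitRel Φ (V × V)).comap
        (Subtype.val : {d : V × V | G.Adj d.1 d.2 ∧ γ d.1 = d.1 ∧ γ d.2 = d.2} → V × V))) := by
  have hV : ∀ v : V, γ v ≠ v := forall_ne_of_apply_eq_zpow_smul hT hadj τ hgen v₀ hstep hfree γ hγadj hcomm hγ₀ hk
  have hV2 : ∀ v : V, γ (γ v) ≠ v := fun v =>
    forall_ne_of_apply_eq_zpow_smul hT hadj τ hgen v₀ hstep hfree (γ.trans γ) (fun a b => by rw [Equiv.trans_apply, Equiv.trans_apply, hγadj, hγadj])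
      (fun φ v => by rw [Equiv.trans_apply, Equiv.trans_apply, hcomm, hcomm]) (k := k + k)
      (by rw [Equiv.trans_apply, hγ₀, ← hcomm, hγ₀, smul_smul, ← zpow_add]) (by omega) v
  haveI h1 : IsEmpty {v : V | γ v = v} := ⟨fun v => hV v.1 v.2⟩
  haveI h2 : IsEmpty {s : Set V | (∃ a b : V, G.Adj a b ∧ s = {a, b}) ∧ γ '' s = s} := ⟨fun s => by
    obtain ⟨⟨a, b, -, hs⟩, hfix⟩ := s.2
    rw [hs, Set.image_pair, Set.pair_eq_pair_iff] at hfix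
    rcases hfix with ⟨ha, -⟩ | ⟨ha, hb⟩
    · exact hV a ha
    · exact hV2 a (by rw [ha, hb])⟩
  haveI h3 : IsEmpty {d : V × V | G.Adj d.1 d.2 ∧ γ d.1 = d.1 ∧ γ d.2 = d.2} := ⟨fun d => hV d.1.1 d.2.2.1⟩
  haveI : IsEmpty (Quotient ((MulAction.orbitRel Φ V).comap (Subtype.val : {v : V | γ v = v} → V))) :=
    ⟨fun q => q.inductionOn fun a => h1.false a⟩
  haveI : IsEmpty (Quotient ((MulAction.orbitRel Φ (Set V)).comap
      (Subtype.val : {s : Set V | (∃ a b : V, G.Adj a b ∧ s = {a, b}) ∧ γ '' s = s} → Set V))) :=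
    ⟨fun q => q.inductionOn fun a => h2.false a⟩
  haveI : IsEmpty (Quotient ((MulAction.orbitRel Φ (V × V)).comap
      (Subtype.val : {d : V × V | G.Adj d.1 d.2 ∧ γ d.1 = d.1 ∧ γ d.2 = d.2} → V × V))) :=
    ⟨fun q => q.inductionOn fun a => h3.false a⟩
  rw [Nat.card_of_isEmpty, Nat.card_of_isEmpty, Nat.card_of_isEmpty]

/-- **PER PERIOD OF `τ`, `#(fixed vertices) + #(set-wise fixed edges) = #(fixed darts)` for every automorphism `γ` commuting with `Φ = τ^ℤ` and moving `v₀` ALONG the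
axis** (`γ v₀ = τ^k v₀` for some `k`: `k = 0` is ★ `natCard_quotient_fixed_vertices_add_edges_eq_darts`, `k ≠ 0` is ★ `…_of_ne`).  In the application (ROAD W): `G` the tree
of `SL₂(F_v)`, `γ = t_x` a split-torus element of `U(Φ₂)(E_w)` acting through `[diag(N x, 1)]`, `τ = t_{ϖ_E}`, `k = ord x`.
[cite: Kottwitz1988, §2 Theorem 2] [cite: Serre1980Trees, I.6.4 Prop. 24–25; II.1.1–1.3] [cite: Laumon1995, Lemma (5.3.2)] -/
theorem natCard_quotient_fixed_vertices_add_edges_eq_darts_of_exists (hT : G.IsTree)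
    (hadj : ∀ (φ : Φ) (a b : V), G.Adj (φ • a) (φ • b) ↔ G.Adj a b) (τ : Φ) (hgen : ∀ φ : Φ, ∃ n : ℤ, τ ^ n = φ) (v₀ : V)
    (hstep : G.Adj v₀ (τ • v₀)) (hfree : ∀ n : ℤ, τ ^ n • v₀ = v₀ → n = 0)
    (γ : V ≃ V) (hγadj : ∀ a b : V, G.Adj (γ a) (γ b) ↔ G.Adj a b) (hcomm : ∀ (φ : Φ) (v : V), φ • γ v = γ (φ • v))
    (hγ₀ : ∃ k : ℤ, γ v₀ = τ ^ k • v₀)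
    (hfinD : Finite (Quotient ((MulAction.orbitRel Φ (V × V)).comap
      (Subtype.val : {d : V × V | G.Adj d.1 d.2 ∧ γ d.1 = d.1 ∧ γ d.2 = d.2} → V × V)))) :
    Nat.card (Quotient ((MulAction.orbitRel Φ V).comap (Subtype.val : {v : V | γ v = v} → V))) +
        Nat.card (Quotient ((MulAction.orbitRel Φ (Set V)).comap
          (Subtype.val : {s : Set V | (∃ a b : V, G.Adj a b ∧ s = {a, b}) ∧ γ '' s = s} → Set V))) =
      Nat.card (Quotient ((MulAction.orbitRel Φ (V × V)).comap
        (Subtype.val : {d : V × V | G.Adj d.1 d.2 ∧ γ d.1 = d.1 ∧ γ d.2 = d.2} → V × V))) := by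
  obtain ⟨k, hk⟩ := hγ₀
  by_cases hk0 : k = 0
  · rw [hk0, zpow_zero, one_smul] at hk
    exact natCard_quotient_fixed_vertices_add_edges_eq_darts hT hadj τ hgen v₀ hstep hfree γ hγadj hcomm hk hfinD
  · exact natCard_quotient_fixed_vertices_add_edges_eq_darts_of_ne hT hadj τ hgen v₀ hstep hfree γ hγadj hcomm hk hk0

end Hyperbolic
end Literature.Combinatorics.SimpleGraph.TreeAction
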